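import Mathlib

/-!
# A locally dominated series of continuous functions is continuous (support, seat p1)

The continuity half of the geometric kernel of a two-period identity (memo §2e (a), STATUS l. 14985):
`K_f(x, y) = Σ_γ f(x⁻¹ γ y)` is continuous as soon as the series converges absolutely and LOCALLY UNIFORMLY —
on a neighbourhood of every point there is one summable majorant `b γ` of all the terms. Abstractly, for
`F : Γ → X → ℂ` with every `F γ` continuous:

  `(∀ x₀, ∃ U ∈ 𝓝 x₀, ∃ b, Summable b ∧ ∀ γ, ∀ x ∈ U, ‖F γ x‖ ≤ b γ) → Continuous (fun x => ∑' γ, F γ x)`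
  (`continuous_tsum_of_locally_dominated`; Mathlib's `continuousOn_tsum` on each neighbourhood),

with the pointwise absolute convergence `summable_norm_of_locally_dominated` and the bound
`norm_tsum_le_of_locally_dominated`. The neighbourhood can be taken compact, which is the «uniformly on compacta»
of the memo (`continuous_tsum_of_dominated_on_compacts`: for a locally compact `X`, a summable majorant on every
compact set suffices). The majorant itself — count × decay on the group, `size(x⁻¹ γ y) ≥ size γ − c` for `x, y`
in a compact set, and the summability of `Σ (1 + size γ)^{−α}` from the polynomial count (`T7SupportDominantTermTail` /
t7-x1's `SummableOfCountDecay`) — is the line's.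

Nothing here is about any group or any period.
Blind lane: Mathlib only; no sorry; axioms ⊆ {propext, Classical.choice, Quot.sound}.
-/

namespace Summit.Ventures.HodgeRepro2.T7SupportPoincareContinuity

open Filter Topology

variable {Γ X : Type*} [TopologicalSpace X]

/-- a locally dominated family: on a neighbourhood of every point, one summable majorant of all the terms -/
def LocallyDominated (F : Γ → X → ℂ) : Prop :=
  ∀ x₀ : X, ∃ U ∈ 𝓝 x₀, ∃ b : Γ → ℝ, Summable b ∧ ∀ γ, ∀ x ∈ U, ‖F γ x‖ ≤ b γ

/-- **pointwise absolute convergence** of a locally dominated series -/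
theorem summable_norm_of_locally_dominated {F : Γ → X → ℂ} (h : LocallyDominated F) (x : X) :
    Summable fun γ => ‖F γ x‖ := by
  obtain ⟨U, hU, b, hb, hFb⟩ := h x
  exact hb.of_nonneg_of_le (fun γ => norm_nonneg _) fun γ => hFb γ x (mem_of_mem_nhds hU)

/-- pointwise convergence of a locally dominated series -/
theorem summable_of_locally_dominated {F : Γ → X → ℂ} (h : LocallyDominated F) (x : X) :
    Summable fun γ => F γ x :=
  (summable_norm_of_locally_dominated h x).of_norm

/-- **continuity of a locally dominated series of continuous functions** -/
theorem continuous_tsum_of_locally_dominated {F : Γ → X → ℂ} (hF : ∀ γ, Continuous (F γ))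
    (h : LocallyDominated F) : Continuous fun x => ∑' γ, F γ x := by
  rw [continuous_iff_continuousAt]
  intro x₀
  obtain ⟨U, hU, b, hb, hFb⟩ := h x₀
  have hcont : ContinuousOn (fun x => ∑' γ, F γ x) U :=
    continuousOn_tsum (fun γ => (hF γ).continuousOn) hb fun γ x hx => hFb γ x hx
  exact hcont.continuousAt hU

omit [TopologicalSpace X] in
/-- the sum is bounded by the sum of the local majorant on the neighbourhood -/
theorem norm_tsum_le_of_locally_dominated {F : Γ → X → ℂ} {U : Set X} {b : Γ → ℝ} (hb : Summable b)
    (hFb : ∀ γ, ∀ x ∈ U, ‖F γ x‖ ≤ b γ) {x : X} (hx : x ∈ U) : ‖∑' γ, F γ x‖ ≤ ∑' γ, b γ :=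
  tsum_of_norm_bounded hb.hasSum fun γ => hFb γ x hx

/-- **a majorant on every compact set suffices** in a locally compact space (the «uniformly on compacta» of the
Poincaré series) -/
theorem locallyDominated_of_compacts [LocallyCompactSpace X] {F : Γ → X → ℂ}
    (h : ∀ K : Set X, IsCompact K → ∃ b : Γ → ℝ, Summable b ∧ ∀ γ, ∀ x ∈ K, ‖F γ x‖ ≤ b γ) :
    LocallyDominated F := by
  intro x₀
  obtain ⟨K, hKc, hK⟩ := exists_compact_mem_nhds x₀
  obtain ⟨b, hb, hFb⟩ := h K hKc
  exact ⟨K, hK, b, hb, hFb⟩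

/-- **continuity from a summable majorant on every compact set** (locally compact `X`) -/
theorem continuous_tsum_of_dominated_on_compacts [LocallyCompactSpace X] {F : Γ → X → ℂ}
    (hF : ∀ γ, Continuous (F γ))
    (h : ∀ K : Set X, IsCompact K → ∃ b : Γ → ℝ, Summable b ∧ ∀ γ, ∀ x ∈ K, ‖F γ x‖ ≤ b γ) :
    Continuous fun x => ∑' γ, F γ x :=
  continuous_tsum_of_locally_dominated hF (locallyDominated_of_compacts h)

end Summit.Ventures.HodgeRepro2.T7SupportPoincareContinuity
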